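import Mathlib
import HarnessLib
import Summits.HubbardSuperconductivity.HubbardSuperconductivity.Theorems.KLProgrammeKLRegimeEngineTowerLipschitz

/-!
# Route `KLProgramme` — crux K3 ENGINE (stmt-HubbardSuperconductivity-20437 `KLRegimeEngineV17F2`), stub (b) v2 (ℓ) (I1) / stub (e) rows C1/C2 (M3):
# the SHARED DIMENSIONLESS CORE under the levelled door→kit bridges — landing-profile weights, parents factors, per-track profiles
# (cell gate-hubbard-kl, seat hubbard-kl-k3c5-p2 g9 on plan g20 (R74b) «shared core brick GO, abstract weights only, no dictionary»)

The prescribed (levels-track) doors — one input (`SectorisedIncrementBoundGradedPrescribedPlateau`, p568996) and two inputs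
(`SectorisedIncrementBoundGradedLipschitzPrescribedPlateau`, p573833) — return their order-`n` graded term for an output with prescribed legs `J` as a sum over
the LANDING PROFILES `pf : J → Fin n` of the prescribed legs on the `n` input slots, with weights `w(δ, pf) = (Π_{j} 2δ_{pf j})/(Σ_a 2δ_a)^{|J|}` and, on slot `a`,
a per-track size `c^{F_a}·X(δ_a, F_a)` (`F_a = |pf⁻¹ a|` prescribed legs landed, `c` = the parents count per landed leg, `X(d, F)` the input's size with `F` legs
constrained).  The kit (`towerBorn_le_law_split`, `towerBornDiff_le_law₄`) reads plain products `Π_a τ^{δ_a} X̄(δ_a)` (`towerS`) or their polarised form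
(`towerSLip`).  This file is the layer-free inequality between the two — NO dictionary, NO door convention (those are the bridges', E1's `…DoorToKitLev` and
my `…DoorToKitLevLip`):

* §1 `sum_card_fiber_eq_card`, `prod_pow_card_fiber_eq` — `Σ_a F_a = |J|`, hence `Π_a c^{F_a} = c^{|J|}` (an OUTPUT constant, not per order);
* §2 `sum_landingWeight_eq_one` / `sum_landingWeight_le_one` — the landing weights sum to EXACTLY `1` (`Finset.prod_univ_sum`; `≤ 1` unconditionally);
* §3 **`sum_weight_prod_levels_le`** — for ANY weights `w ≥ 0` with `Σ_pf w ≤ 1` and per-track sizes `0 ≤ X(d, F) ≤ X̄(d)`: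
  `Σ_pf w(pf)·Π_a τ^{δ_a}·(c^{F_a} X(δ_a, F_a)) ≤ c^{|J|}·Π_a τ^{δ_a} X̄(δ_a)`;
  **`sum_weight_sum_mul_prod_erase_levels_le`** — the polarised form (ONE slot carries `Xν ≤ X̄ν`, the others `Xμ ≤ X̄μ`):
  `Σ_pf w·Σ_a τ^{δ_a}(c^{F_a} Xν(δ_a,F_a))·Π_{b≠a} τ^{δ_b}(c^{F_b} Xμ(δ_b,F_b)) ≤ c^{|J|}·Σ_a τ^{δ_a} X̄ν(δ_a)·Π_{b≠a} τ^{δ_b} X̄μ(δ_b)`;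
* §4 summed over the kit's index set: **`sum_tracksLevels_le_mul_towerS`**, **`sum_tracksLevels_le_mul_towerSLip`** (`≤ c^{|J|}·towerS D τ X̄ n p`,
  `≤ c^{|J|}·towerSLip D τ X̄ν X̄μ n p`).
Pure real analysis; nothing about the model is asserted.
-/

noncomputable section

namespace Summit.HubbardSuperconductivity.HubbardSuperconductivity.Theorems.EngineV8

set_option linter.dupNamespace false -- summit = problem name (single-conjunct summit), D-0017

open Real Finset

/-! ## §1 Landing counts: the fibres of a landing profile partition the prescribed legs -/

/-- **`Σ_a |pf⁻¹ a| = |J|`**: the fibres of a landing profile `pf : J → Fin n` partition `J`. -/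
theorem sum_card_fiber_eq_card {ι : Type*} [Fintype ι] {n : ℕ} (pf : ι → Fin n) :
    ∑ a : Fin n, (univ.filter fun j : ι => pf j = a).card = Fintype.card ι := by
  classical
  rw [← Finset.card_univ, ← Finset.card_biUnion]
  · congr 1
    ext j
    simp only [mem_biUnion, mem_univ, mem_filter, true_and, exists_eq']
  · intro a _ b _ hab
    exact disjoint_filter.2 fun j _ ha hb => hab (ha ▸ hb)

/-- **`Π_a c^{|pf⁻¹ a|} = c^{|J|}`**: the parents factors of a landing profile multiply to an OUTPUT constant. -/
theorem prod_pow_card_fiber_eq {ι : Type*} [Fintype ι] {n : ℕ} (pf : ι → Fin n) (c : ℝ) :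
    ∏ a : Fin n, c ^ (univ.filter fun j : ι => pf j = a).card = c ^ Fintype.card ι := by
  rw [prod_pow_eq_pow_sum, sum_card_fiber_eq_card]

/-! ## §2 The landing weights sum to one -/

/-- **The landing weights sum to EXACTLY one** when the total input degree is positive:
`Σ_{pf : J → Fin n} (Π_j 2δ_{pf j})/(Σ_a 2δ_a)^{|J|} = 1`. -/
theorem sum_landingWeight_eq_one {ι : Type*} [Fintype ι] [DecidableEq ι] {n : ℕ} (δ : Fin n → ℕ) (hpos : 0 < ∑ a, δ a) :
    ∑ pf : ι → Fin n, (∏ j, ((2 * δ (pf j) : ℕ) : ℝ)) / (((∑ a, 2 * δ a : ℕ) : ℝ)) ^ Fintype.card ι = 1 := by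
  have h2 : (∑ a, 2 * δ a) = 2 * ∑ a, δ a := by rw [mul_sum]
  have hS0 : (((∑ a, 2 * δ a : ℕ) : ℝ)) ≠ 0 := by exact_mod_cast (show ∑ a, 2 * δ a ≠ 0 by omega)
  have hS : (((∑ a, 2 * δ a : ℕ) : ℝ)) = ∑ a : Fin n, ((2 * δ a : ℕ) : ℝ) := Nat.cast_sum _ _
  rw [← sum_div, div_eq_one_iff_eq (pow_ne_zero _ hS0), hS, ← card_univ, ← prod_const, Finset.prod_univ_sum,
    Fintype.piFinset_univ]

/-- **The landing weights sum to at most one**, unconditionally (when the total degree vanishes every weight is `0` or the product is empty). -/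
theorem sum_landingWeight_le_one {ι : Type*} [Fintype ι] [DecidableEq ι] {n : ℕ} (δ : Fin n → ℕ) :
    ∑ pf : ι → Fin n, (∏ j, ((2 * δ (pf j) : ℕ) : ℝ)) / (((∑ a, 2 * δ a : ℕ) : ℝ)) ^ Fintype.card ι ≤ 1 := by
  classical
  rcases Nat.eq_zero_or_pos (∑ a, δ a) with h0 | hpos
  · have hδ : ∀ a, δ a = 0 := fun a =>
      Nat.eq_zero_of_le_zero (h0 ▸ single_le_sum (fun b _ => Nat.zero_le (δ b)) (mem_univ a))
    rcases isEmpty_or_nonempty ι with hι | hι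
    · have hc : Fintype.card ι = 0 := Fintype.card_eq_zero
      have huniq : Fintype.card (ι → Fin n) = 1 := by rw [Fintype.card_fun, hc, pow_zero]
      rw [sum_congr rfl fun pf _ => by rw [univ_eq_empty, prod_empty, hc, pow_zero, div_one], sum_const, card_univ, huniq, one_smul]
    · obtain ⟨j₀⟩ := hι
      have hz : ∀ pf : ι → Fin n, (∏ j, ((2 * δ (pf j) : ℕ) : ℝ)) / (((∑ a, 2 * δ a : ℕ) : ℝ)) ^ Fintype.card ι = 0 := fun pf => by
        rw [prod_eq_zero (mem_univ j₀) (by rw [hδ]; norm_num), zero_div]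
      rw [sum_congr rfl fun pf _ => hz pf, sum_const_zero]
      exact zero_le_one
  · exact (sum_landingWeight_eq_one δ hpos).le

/-! ## §3 The core inequality, plain and polarised -/

/-- **THE SHARED CORE INEQUALITY (plain form).**  Weights `w ≥ 0` with `Σ_pf w(pf) ≤ 1` (e.g. the landing weights, possibly times unit ratios `≤ 1`),
per-track sizes `0 ≤ X(d, F) ≤ X̄(d)` (`F` = legs landed; prescribing legs only drops tuples), parents constant `c ≥ 0`, per-leg-pair weight `τ ≥ 0`.  Then
`Σ_pf w(pf)·Π_a τ^{δ_a}·(c^{|pf⁻¹ a|}·X(δ_a, |pf⁻¹ a|)) ≤ c^{|J|}·Π_a τ^{δ_a}·X̄(δ_a)`. -/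
theorem sum_weight_prod_levels_le {ι : Type*} [Fintype ι] [DecidableEq ι] {n : ℕ} {δ : Fin n → ℕ} {w : (ι → Fin n) → ℝ} {τ c : ℝ}
    {X : ℕ → ℕ → ℝ} {Xb : ℕ → ℝ} (hτ : 0 ≤ τ) (hc : 0 ≤ c) (hw0 : ∀ pf, 0 ≤ w pf) (hw1 : ∑ pf, w pf ≤ 1)
    (hX0 : ∀ d F, 0 ≤ X d F) (hXle : ∀ d F, X d F ≤ Xb d) :
    ∑ pf : ι → Fin n, w pf * ∏ a, τ ^ (δ a) * (c ^ (univ.filter fun j : ι => pf j = a).card * X (δ a) (univ.filter fun j : ι => pf j = a).card) ≤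
      c ^ Fintype.card ι * ∏ a, τ ^ (δ a) * Xb (δ a) := by
  classical
  have hXb0 : ∀ d, 0 ≤ Xb d := fun d => (hX0 d 0).trans (hXle d 0)
  have hP0 : 0 ≤ ∏ a, τ ^ (δ a) * Xb (δ a) := prod_nonneg fun a _ => mul_nonneg (pow_nonneg hτ _) (hXb0 _)
  have hstep : ∀ pf : ι → Fin n,
      ∏ a, τ ^ (δ a) * (c ^ (univ.filter fun j : ι => pf j = a).card * X (δ a) (univ.filter fun j : ι => pf j = a).card) ≤
        c ^ Fintype.card ι * ∏ a, τ ^ (δ a) * Xb (δ a) := by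
    intro pf
    calc ∏ a, τ ^ (δ a) * (c ^ (univ.filter fun j : ι => pf j = a).card * X (δ a) (univ.filter fun j : ι => pf j = a).card)
        ≤ ∏ a, τ ^ (δ a) * (c ^ (univ.filter fun j : ι => pf j = a).card * Xb (δ a)) :=
          prod_le_prod (fun a _ => mul_nonneg (pow_nonneg hτ _) (mul_nonneg (pow_nonneg hc _) (hX0 _ _)))
            fun a _ => mul_le_mul_of_nonneg_left (mul_le_mul_of_nonneg_left (hXle _ _) (pow_nonneg hc _)) (pow_nonneg hτ _)
      _ = (∏ a, c ^ (univ.filter fun j : ι => pf j = a).card) * ∏ a, τ ^ (δ a) * Xb (δ a) := by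
          rw [← prod_mul_distrib]; exact prod_congr rfl fun a _ => by ring
      _ = c ^ Fintype.card ι * ∏ a, τ ^ (δ a) * Xb (δ a) := by rw [prod_pow_card_fiber_eq]
  calc ∑ pf : ι → Fin n, w pf * ∏ a, τ ^ (δ a) * (c ^ (univ.filter fun j : ι => pf j = a).card * X (δ a) (univ.filter fun j : ι => pf j = a).card)
      ≤ ∑ pf : ι → Fin n, w pf * (c ^ Fintype.card ι * ∏ a, τ ^ (δ a) * Xb (δ a)) :=
        sum_le_sum fun pf _ => mul_le_mul_of_nonneg_left (hstep pf) (hw0 pf)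
    _ = (∑ pf : ι → Fin n, w pf) * (c ^ Fintype.card ι * ∏ a, τ ^ (δ a) * Xb (δ a)) := by rw [sum_mul]
    _ ≤ 1 * (c ^ Fintype.card ι * ∏ a, τ ^ (δ a) * Xb (δ a)) := mul_le_mul_of_nonneg_right hw1 (mul_nonneg (pow_nonneg hc _) hP0)
    _ = c ^ Fintype.card ι * ∏ a, τ ^ (δ a) * Xb (δ a) := one_mul _

/-- **THE SHARED CORE INEQUALITY (polarised form)**: ONE slot carries the difference-track sizes `0 ≤ Xν(d, F) ≤ X̄ν(d)`, the others the majorant-track sizes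
`0 ≤ Xμ(d, F) ≤ X̄μ(d)`; weights `w ≥ 0`, `Σ w ≤ 1`; `c, τ ≥ 0`.  Then
`Σ_pf w·Σ_a τ^{δ_a}(c^{F_a} Xν(δ_a,F_a))·Π_{b≠a} τ^{δ_b}(c^{F_b} Xμ(δ_b,F_b)) ≤ c^{|J|}·Σ_a τ^{δ_a} X̄ν(δ_a)·Π_{b≠a} τ^{δ_b} X̄μ(δ_b)`. -/
theorem sum_weight_sum_mul_prod_erase_levels_le {ι : Type*} [Fintype ι] [DecidableEq ι] {n : ℕ} {δ : Fin n → ℕ} {w : (ι → Fin n) → ℝ} {τ c : ℝ}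
    {Xν Xμ : ℕ → ℕ → ℝ} {Xνb Xμb : ℕ → ℝ} (hτ : 0 ≤ τ) (hc : 0 ≤ c) (hw0 : ∀ pf, 0 ≤ w pf) (hw1 : ∑ pf, w pf ≤ 1)
    (hXν0 : ∀ d F, 0 ≤ Xν d F) (hXνle : ∀ d F, Xν d F ≤ Xνb d) (hXμ0 : ∀ d F, 0 ≤ Xμ d F) (hXμle : ∀ d F, Xμ d F ≤ Xμb d) :
    ∑ pf : ι → Fin n, w pf * ∑ a, τ ^ (δ a) * (c ^ (univ.filter fun j : ι => pf j = a).card * Xν (δ a) (univ.filter fun j : ι => pf j = a).card) *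
        ∏ b ∈ univ.erase a, τ ^ (δ b) * (c ^ (univ.filter fun j : ι => pf j = b).card * Xμ (δ b) (univ.filter fun j : ι => pf j = b).card) ≤
      c ^ Fintype.card ι * ∑ a, τ ^ (δ a) * Xνb (δ a) * ∏ b ∈ univ.erase a, τ ^ (δ b) * Xμb (δ b) := by
  classical
  have hXνb0 : ∀ d, 0 ≤ Xνb d := fun d => (hXν0 d 0).trans (hXνle d 0)
  have hXμb0 : ∀ d, 0 ≤ Xμb d := fun d => (hXμ0 d 0).trans (hXμle d 0)
  set F : (ι → Fin n) → Fin n → ℕ := fun pf a => (univ.filter fun j : ι => pf j = a).card with hF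
  have hR0 : 0 ≤ ∑ a, τ ^ (δ a) * Xνb (δ a) * ∏ b ∈ univ.erase a, τ ^ (δ b) * Xμb (δ b) :=
    sum_nonneg fun a _ => mul_nonneg (mul_nonneg (pow_nonneg hτ _) (hXνb0 _))
      (prod_nonneg fun b _ => mul_nonneg (pow_nonneg hτ _) (hXμb0 _))
  have hstep : ∀ pf : ι → Fin n,
      ∑ a, τ ^ (δ a) * (c ^ F pf a * Xν (δ a) (F pf a)) * ∏ b ∈ univ.erase a, τ ^ (δ b) * (c ^ F pf b * Xμ (δ b) (F pf b)) ≤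
        c ^ Fintype.card ι * ∑ a, τ ^ (δ a) * Xνb (δ a) * ∏ b ∈ univ.erase a, τ ^ (δ b) * Xμb (δ b) := by
    intro pf
    have hcprod : ∀ a, c ^ F pf a * ∏ b ∈ univ.erase a, c ^ F pf b = c ^ Fintype.card ι := fun a => by
      rw [mul_prod_erase univ (fun b => c ^ F pf b) (mem_univ a)]
      exact prod_pow_card_fiber_eq pf c
    rw [mul_sum]
    refine sum_le_sum fun a _ => ?_
    calc τ ^ (δ a) * (c ^ F pf a * Xν (δ a) (F pf a)) * ∏ b ∈ univ.erase a, τ ^ (δ b) * (c ^ F pf b * Xμ (δ b) (F pf b))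
        ≤ τ ^ (δ a) * (c ^ F pf a * Xνb (δ a)) * ∏ b ∈ univ.erase a, τ ^ (δ b) * (c ^ F pf b * Xμb (δ b)) :=
          mul_le_mul (mul_le_mul_of_nonneg_left (mul_le_mul_of_nonneg_left (hXνle _ _) (pow_nonneg hc _)) (pow_nonneg hτ _))
            (prod_le_prod (fun b _ => mul_nonneg (pow_nonneg hτ _) (mul_nonneg (pow_nonneg hc _) (hXμ0 _ _)))
              fun b _ => mul_le_mul_of_nonneg_left (mul_le_mul_of_nonneg_left (hXμle _ _) (pow_nonneg hc _)) (pow_nonneg hτ _))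
            (prod_nonneg fun b _ => mul_nonneg (pow_nonneg hτ _) (mul_nonneg (pow_nonneg hc _) (hXμ0 _ _)))
            (mul_nonneg (pow_nonneg hτ _) (mul_nonneg (pow_nonneg hc _) (hXνb0 _)))
      _ = (c ^ F pf a * ∏ b ∈ univ.erase a, c ^ F pf b) * (τ ^ (δ a) * Xνb (δ a) * ∏ b ∈ univ.erase a, τ ^ (δ b) * Xμb (δ b)) := by
          rw [mul_mul_mul_comm, ← prod_mul_distrib]
          congr 1
          · ring
          · exact prod_congr rfl fun b _ => by ring
      _ = c ^ Fintype.card ι * (τ ^ (δ a) * Xνb (δ a) * ∏ b ∈ univ.erase a, τ ^ (δ b) * Xμb (δ b)) := by rw [hcprod a]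
  calc ∑ pf : ι → Fin n, w pf * ∑ a, τ ^ (δ a) * (c ^ F pf a * Xν (δ a) (F pf a)) *
          ∏ b ∈ univ.erase a, τ ^ (δ b) * (c ^ F pf b * Xμ (δ b) (F pf b))
      ≤ ∑ pf : ι → Fin n, w pf * (c ^ Fintype.card ι * ∑ a, τ ^ (δ a) * Xνb (δ a) * ∏ b ∈ univ.erase a, τ ^ (δ b) * Xμb (δ b)) :=
        sum_le_sum fun pf _ => mul_le_mul_of_nonneg_left (hstep pf) (hw0 pf)
    _ = (∑ pf : ι → Fin n, w pf) * (c ^ Fintype.card ι * ∑ a, τ ^ (δ a) * Xνb (δ a) * ∏ b ∈ univ.erase a, τ ^ (δ b) * Xμb (δ b)) := by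
        rw [sum_mul]
    _ ≤ 1 * (c ^ Fintype.card ι * ∑ a, τ ^ (δ a) * Xνb (δ a) * ∏ b ∈ univ.erase a, τ ^ (δ b) * Xμb (δ b)) :=
        mul_le_mul_of_nonneg_right hw1 (mul_nonneg (pow_nonneg hc _) hR0)
    _ = _ := one_mul _

/-! ## §4 Summed over the kit's index set -/

/-- **Summed, plain**: over `δ ∈ [1,D]^n` with the kit's leg constraint, with `δ`-dependent weights `w(δ, ·)` (each `≥ 0`, summing to `≤ 1`), the tracks-levels graded
sum is at most `c^{|J|}·towerS D τ X̄ n p`. -/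
theorem sum_tracksLevels_le_mul_towerS {ι : Type*} [Fintype ι] [DecidableEq ι] {D n p : ℕ} {w : (Fin n → ℕ) → (ι → Fin n) → ℝ} {τ c : ℝ}
    {X : ℕ → ℕ → ℝ} {Xb : ℕ → ℝ} (hτ : 0 ≤ τ) (hc : 0 ≤ c) (hw0 : ∀ δ pf, 0 ≤ w δ pf) (hw1 : ∀ δ, ∑ pf, w δ pf ≤ 1)
    (hX0 : ∀ d F, 0 ≤ X d F) (hXle : ∀ d F, X d F ≤ Xb d) :
    ∑ δ ∈ (Fintype.piFinset fun _ : Fin n => Icc 1 D) with p + n - 1 ≤ ∑ a, δ a,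
        ∑ pf : ι → Fin n, w δ pf *
          ∏ a, τ ^ (δ a) * (c ^ (univ.filter fun j : ι => pf j = a).card * X (δ a) (univ.filter fun j : ι => pf j = a).card) ≤
      c ^ Fintype.card ι * towerS D τ Xb n p := by
  unfold towerS
  rw [mul_sum]
  exact sum_le_sum fun δ _ => sum_weight_prod_levels_le hτ hc (hw0 δ) (hw1 δ) hX0 hXle

/-- **Summed, polarised**: the tracks-levels mixed graded sum is at most `c^{|J|}·towerSLip D τ X̄ν X̄μ n p`. -/
theorem sum_tracksLevels_le_mul_towerSLip {ι : Type*} [Fintype ι] [DecidableEq ι] {D n p : ℕ} {w : (Fin n → ℕ) → (ι → Fin n) → ℝ} {τ c : ℝ}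
    {Xν Xμ : ℕ → ℕ → ℝ} {Xνb Xμb : ℕ → ℝ} (hτ : 0 ≤ τ) (hc : 0 ≤ c) (hw0 : ∀ δ pf, 0 ≤ w δ pf) (hw1 : ∀ δ, ∑ pf, w δ pf ≤ 1)
    (hXν0 : ∀ d F, 0 ≤ Xν d F) (hXνle : ∀ d F, Xν d F ≤ Xνb d) (hXμ0 : ∀ d F, 0 ≤ Xμ d F) (hXμle : ∀ d F, Xμ d F ≤ Xμb d) :
    ∑ δ ∈ (Fintype.piFinset fun _ : Fin n => Icc 1 D) with p + n - 1 ≤ ∑ a, δ a,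
        ∑ pf : ι → Fin n, w δ pf *
          ∑ a, τ ^ (δ a) * (c ^ (univ.filter fun j : ι => pf j = a).card * Xν (δ a) (univ.filter fun j : ι => pf j = a).card) *
            ∏ b ∈ univ.erase a, τ ^ (δ b) * (c ^ (univ.filter fun j : ι => pf j = b).card * Xμ (δ b) (univ.filter fun j : ι => pf j = b).card) ≤
      c ^ Fintype.card ι * towerSLip D τ Xνb Xμb n p := by
  unfold towerSLip
  rw [mul_sum]
  exact sum_le_sum fun δ _ => sum_weight_sum_mul_prod_erase_levels_le hτ hc (hw0 δ) (hw1 δ) hXν0 hXνle hXμ0 hXμle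

end Summit.HubbardSuperconductivity.HubbardSuperconductivity.Theorems.EngineV8

end
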